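import Summits.CriticalPhenomena.CardyFormulaZ2.Theses.CardyQContinuation
import Literature.Probability.RandomPlanarGeometry.PolygonalDomains
import Literature.Analysis.Complex.MergelyanLemma

/-!
# The exterior of a Jordan domain, inverted about an interior point, is a Jordan domain
(route CardyQContinuation, serves stmt-CriticalPhenomena-5560, registered stub
`stub_loopSymmetricLimit_exteriorInversion` of the n = 0 bridge of the crux `IsingJetsConformal`)

The continuum design of the n = 0 sandwich needs nice Jordan curves OUTSIDE a given Jordan domain
`D` converging to its boundary arcs; they come from the exterior Riemann map, i.e. the interior
Riemann map of the bounded Jordan domain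
`D* := {0} ∪ {w ≠ 0 : z₀ + w⁻¹ ∉ closure D}` — the exterior of `D` inverted about an interior point
`z₀ ∈ D`. This file constructs `D*` as a `JordanDomain` (`JordanDomain.ofLoop` of the inverted
boundary loop `t ↦ (D.boundary t - z₀)⁻¹`, using the Jordan curve theorem proved in the tree) and
identifies its carrier.

Proof of the carrier identification (sub-namespace `ExteriorInversion`). Let `γ t := (D.boundary
t - z₀)⁻¹`, `T := {0} ∪ {w ≠ 0 : z₀ + w⁻¹ ∉ closure D}` and `S := {w ≠ 0 : z₀ + w⁻¹ ∈ D}`. Then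
`T`, `S` are open (`0` is interior to `T` because `closure D` is bounded; off `0` inversion is
continuous, `Literature.Analysis.Complex.isOpen_setOf_inv_mem`), disjoint, `T` is bounded
(`z₀` is interior to `D`), `T ⊆ (range γ)ᶜ ⊆ T ∪ S`. By the Jordan curve theorem
`(range γ)ᶜ = inside ⊔ outside` with connected pieces, the outside unbounded: the outside lies in
`T` or in `S`, not in the bounded `T`, so in `S`; hence `0 ∈ inside`, so the connected inside lies
in `T`; and `T ⊆ inside ∪ outside` with `T ∩ outside ⊆ T ∩ S = ∅` gives `T = inside`. No
connectivity of `T` or `S` is needed. [folklore]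

References: Ch. Pommerenke, *Boundary behaviour of conformal maps* (1992), §2.2 (exterior maps via
inversion); J. McCleary, *A First Course in Topology* (2006), Ch. 9 (Jordan curve theorem).
-/

namespace Summit.CriticalPhenomena.CardyFormulaZ2.Theorems.CardyQContinuation

open Set Metric Literature.Probability.RandomPlanarGeometry

namespace ExteriorInversion

variable (D : JordanDomain)

/-- A boundary point of a Jordan domain is not an interior point. [folklore] -/
theorem boundary_ne {z₀ : ℂ} (hz₀ : z₀ ∈ D.carrier) (t : ℝ) : D.boundary t ≠ z₀ := fun h =>
  Set.disjoint_left.1 D.disjoint_carrier_frontier hz₀ (h ▸ D.boundary_mem_frontier t)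

/-- The inverted boundary loop `t ↦ (D.boundary t - z₀)⁻¹` is continuous (for `z₀ ∈ D`).
[folklore] -/
theorem continuous_invLoop {z₀ : ℂ} (hz₀ : z₀ ∈ D.carrier) :
    Continuous fun t : ℝ => (D.boundary t - z₀)⁻¹ :=
  (D.continuous_boundary.sub continuous_const).inv₀ fun t => sub_ne_zero.2 (boundary_ne D hz₀ t)

/-- The inverted boundary loop is `1`-periodic. [folklore] -/
theorem periodic_invLoop (z₀ : ℂ) : Function.Periodic (fun t : ℝ => (D.boundary t - z₀)⁻¹) 1 :=
  fun t => by simp only [D.periodic_boundary t]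

/-- The inverted boundary loop is injective on a period. [folklore] -/
theorem injOn_invLoop (z₀ : ℂ) : InjOn (fun t : ℝ => (D.boundary t - z₀)⁻¹) (Ico 0 1) :=
  fun _ hs _ ht h => D.injOn_boundary hs ht (sub_left_inj.1 (inv_inj.1 h))

/-- A point lies on the inverted loop iff it is nonzero and `z₀ + w⁻¹` is a boundary point of `D`.
[folklore] -/
theorem mem_range_invLoop_iff {z₀ : ℂ} (hz₀ : z₀ ∈ D.carrier) {w : ℂ} :
    w ∈ range (fun t : ℝ => (D.boundary t - z₀)⁻¹) ↔ w ≠ 0 ∧ z₀ + w⁻¹ ∈ frontier D.carrier := by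
  constructor
  · rintro ⟨t, rfl⟩
    dsimp only
    refine ⟨inv_ne_zero (sub_ne_zero.2 (boundary_ne D hz₀ t)), ?_⟩
    rw [inv_inv, add_sub_cancel]
    exact D.boundary_mem_frontier t
  · rintro ⟨-, hwf⟩
    rw [← D.range_boundary] at hwf
    obtain ⟨t, ht⟩ := hwf
    exact ⟨t, by simp only [ht, add_sub_cancel_left, inv_inv]⟩

/-- The model set `T = {0} ∪ {w ≠ 0 : z₀ + w⁻¹ ∉ closure D}` of the inverted exterior is open:
`0` is an interior point because `closure D` is bounded. [folklore] -/
theorem isOpen_model (z₀ : ℂ) :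
    IsOpen {w : ℂ | w = 0 ∨ (w ≠ 0 ∧ z₀ + w⁻¹ ∉ closure D.carrier)} := by
  obtain ⟨R, hR0, hR⟩ := D.isBounded.closure.subset_closedBall_lt 0 z₀
  rw [isOpen_iff_mem_nhds]
  intro w hw
  rcases eq_or_ne w 0 with rfl | hw0
  · refine Filter.mem_of_superset (Metric.ball_mem_nhds (0 : ℂ) (inv_pos.2 hR0)) ?_
    intro v hv
    rcases eq_or_ne v 0 with rfl | hv0
    · exact Or.inl rfl
    · refine Or.inr ⟨hv0, fun hmem => ?_⟩
      have h1 := hR hmem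
      rw [Metric.mem_closedBall, dist_eq_norm, add_sub_cancel_left, norm_inv] at h1
      rw [Metric.mem_ball, dist_zero_right] at hv
      exact absurd h1 (not_le.2 ((lt_inv_comm₀ (norm_pos_iff.2 hv0) hR0).1 hv))
  · have hw' : w ∈ {w : ℂ | w ≠ 0 ∧ z₀ + w⁻¹ ∈ (closure D.carrier)ᶜ} :=
      ⟨hw0, (hw.resolve_left hw0).2⟩
    exact Filter.mem_of_superset ((Literature.Analysis.Complex.isOpen_setOf_inv_mem
      isClosed_closure.isOpen_compl z₀).mem_nhds hw') fun v hv => Or.inr hv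

/-- The model set `T` is bounded: `z₀` is an interior point of `D`, so `z₀ + w⁻¹ ∉ D` forces
`‖w⁻¹‖ ≥ r₀`. [folklore] -/
theorem isBounded_model {z₀ : ℂ} (hz₀ : z₀ ∈ D.carrier) :
    Bornology.IsBounded {w : ℂ | w = 0 ∨ (w ≠ 0 ∧ z₀ + w⁻¹ ∉ closure D.carrier)} := by
  obtain ⟨r, hr0, hr⟩ := Metric.isOpen_iff.1 D.isOpen z₀ hz₀
  refine (Metric.isBounded_closedBall (x := (0 : ℂ)) (r := r⁻¹)).subset ?_
  rintro w (rfl | ⟨hw0, hw⟩)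
  · exact Metric.mem_closedBall_self (inv_nonneg.2 hr0.le)
  · rw [Metric.mem_closedBall, dist_zero_right]
    have h1 : z₀ + w⁻¹ ∉ Metric.ball z₀ r := fun h => hw (subset_closure (hr h))
    rw [Metric.mem_ball, dist_eq_norm, add_sub_cancel_left, norm_inv, not_lt] at h1
    exact (le_inv_comm₀ hr0 (norm_pos_iff.2 hw0)).1 h1

/-- The model sets `T` (inverted exterior) and `S` (inverted punctured interior) are disjoint.
[folklore] -/
theorem disjoint_model (z₀ : ℂ) :
    Disjoint {w : ℂ | w = 0 ∨ (w ≠ 0 ∧ z₀ + w⁻¹ ∉ closure D.carrier)}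
      {w : ℂ | w ≠ 0 ∧ z₀ + w⁻¹ ∈ D.carrier} := by
  refine Set.disjoint_left.2 ?_
  rintro w (rfl | ⟨-, hw⟩) ⟨hw0', hw'⟩
  · exact hw0' rfl
  · exact hw (subset_closure hw')

/-- Off the inverted loop, a point is in `T` or in `S` (the plane is `D ⊔ ∂D ⊔ exterior`).
[folklore] -/
theorem compl_range_subset_union {z₀ : ℂ} (hz₀ : z₀ ∈ D.carrier) :
    (range fun t : ℝ => (D.boundary t - z₀)⁻¹)ᶜ ⊆
      {w : ℂ | w = 0 ∨ (w ≠ 0 ∧ z₀ + w⁻¹ ∉ closure D.carrier)} ∪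
        {w : ℂ | w ≠ 0 ∧ z₀ + w⁻¹ ∈ D.carrier} := by
  intro w hw
  rcases eq_or_ne w 0 with rfl | hw0
  · exact Or.inl (Or.inl rfl)
  · have hnf : z₀ + w⁻¹ ∉ frontier D.carrier := fun h =>
      hw ((mem_range_invLoop_iff D hz₀).2 ⟨hw0, h⟩)
    by_cases hD : z₀ + w⁻¹ ∈ D.carrier
    · exact Or.inr ⟨hw0, hD⟩
    · refine Or.inl (Or.inr ⟨hw0, ?_⟩)
      rw [closure_eq_self_union_frontier]
      rintro (h | h)
      exacts [hD h, hnf h]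

/-- The model set `T` misses the inverted loop. [folklore] -/
theorem model_subset_compl_range {z₀ : ℂ} (hz₀ : z₀ ∈ D.carrier) :
    {w : ℂ | w = 0 ∨ (w ≠ 0 ∧ z₀ + w⁻¹ ∉ closure D.carrier)} ⊆
      (range fun t : ℝ => (D.boundary t - z₀)⁻¹)ᶜ := by
  rintro w hw hmem
  obtain ⟨hw0, hwf⟩ := (mem_range_invLoop_iff D hz₀).1 hmem
  rcases hw with rfl | ⟨-, hw⟩
  · exact hw0 rfl
  · exact hw (frontier_subset_closure hwf)

/-- **Carrier of the inverted exterior.** The Jordan domain bounded by the inverted loop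
`t ↦ (D.boundary t - z₀)⁻¹` has carrier `{0} ∪ {w ≠ 0 : z₀ + w⁻¹ ∉ closure D}`. [folklore] -/
theorem mem_carrier_ofLoop_invLoop_iff {z₀ : ℂ} (hz₀ : z₀ ∈ D.carrier) (w : ℂ) :
    w ∈ (JordanDomain.ofLoop (continuous_invLoop D hz₀) (periodic_invLoop D z₀)
        (injOn_invLoop D z₀)).carrier ↔
      w = 0 ∨ (w ≠ 0 ∧ z₀ + w⁻¹ ∉ closure D.carrier) := by
  have hTo := isOpen_model D z₀
  have hSo : IsOpen {w : ℂ | w ≠ 0 ∧ z₀ + w⁻¹ ∈ D.carrier} :=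
    Literature.Analysis.Complex.isOpen_setOf_inv_mem D.isOpen z₀
  have hTS := disjoint_model D z₀
  have hcov := compl_range_subset_union D hz₀
  have hTsub := model_subset_compl_range D hz₀
  obtain ⟨V, -, hVc, -, hunion, -, hVb⟩ :=
    (JordanDomain.ofLoop (continuous_invLoop D hz₀) (periodic_invLoop D z₀)
      (injOn_invLoop D z₀)).exists_outside
      Literature.Topology.PlaneTopology.JordanCurveTheorem_holds
  rw [JordanDomain.frontier_ofLoop_carrier] at hunion
  -- the outside lies in `S`
  have hVS : V ⊆ {w : ℂ | w ≠ 0 ∧ z₀ + w⁻¹ ∈ D.carrier} := by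
    have hV : V ⊆ {w : ℂ | w = 0 ∨ (w ≠ 0 ∧ z₀ + w⁻¹ ∉ closure D.carrier)} ∪
        {w : ℂ | w ≠ 0 ∧ z₀ + w⁻¹ ∈ D.carrier} :=
      fun v hv => hcov (by rw [← hunion]; exact Or.inr hv)
    rcases hVc.isPreconnected.subset_or_subset hTo hSo hTS hV with h | h
    · exact absurd ((isBounded_model D hz₀).subset h) hVb
    · exact h
  -- hence `0` is inside, and the inside lies in `T`
  have h0 : (0 : ℂ) ∈ (JordanDomain.ofLoop (continuous_invLoop D hz₀) (periodic_invLoop D z₀)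
      (injOn_invLoop D z₀)).carrier := by
    have h0' : (0 : ℂ) ∈ (JordanDomain.ofLoop (continuous_invLoop D hz₀) (periodic_invLoop D z₀)
        (injOn_invLoop D z₀)).carrier ∪ V := by
      rw [hunion]
      exact hTsub (Or.inl rfl)
    exact h0'.resolve_right fun h => (hVS h).1 rfl
  have hDT : (JordanDomain.ofLoop (continuous_invLoop D hz₀) (periodic_invLoop D z₀)
      (injOn_invLoop D z₀)).carrier ⊆
        {w : ℂ | w = 0 ∨ (w ≠ 0 ∧ z₀ + w⁻¹ ∉ closure D.carrier)} := by
    have hD : (JordanDomain.ofLoop (continuous_invLoop D hz₀) (periodic_invLoop D z₀)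
        (injOn_invLoop D z₀)).carrier ⊆
          {w : ℂ | w = 0 ∨ (w ≠ 0 ∧ z₀ + w⁻¹ ∉ closure D.carrier)} ∪
            {w : ℂ | w ≠ 0 ∧ z₀ + w⁻¹ ∈ D.carrier} :=
      fun v hv => hcov (by rw [← hunion]; exact Or.inl hv)
    rcases (JordanDomain.isConnected _).isPreconnected.subset_or_subset hTo hSo hTS hD with h | h
    · exact h
    · exact absurd rfl (h h0).1
  constructor
  · exact fun h => hDT h
  · intro hw
    have hw' : w ∈ (JordanDomain.ofLoop (continuous_invLoop D hz₀) (periodic_invLoop D z₀)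
        (injOn_invLoop D z₀)).carrier ∪ V := by
      rw [hunion]
      exact hTsub hw
    exact hw'.resolve_right fun hV => Set.disjoint_left.1 hTS hw (hVS hV)

end ExteriorInversion

/-- **Registered stub `stub_loopSymmetricLimit_exteriorInversion`** of the n = 0 bridge of the crux
`IsingJetsConformal` (stmt-CriticalPhenomena-5560): for a Jordan domain `D` and an interior point
`z₀`, the exterior of `D` inverted about `z₀` — `{0} ∪ {w ≠ 0 : z₀ + w⁻¹ ∉ closure D}` — is the
carrier of a Jordan domain whose boundary loop is the inverted loop `t ↦ (D.boundary t - z₀)⁻¹`.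
[folklore] -/
theorem stub_loopSymmetricLimit_exteriorInversion : (∀ (D : Literature.Probability.RandomPlanarGeometry.JordanDomain) (z₀ : ℂ), z₀ ∈ D.carrier → ∃ Ds : Literature.Probability.RandomPlanarGeometry.JordanDomain, (∀ w : ℂ, w ∈ Ds.carrier ↔ w = 0 ∨ (w ≠ 0 ∧ z₀ + w⁻¹ ∉ closure D.carrier)) ∧ (∀ t : ℝ, Ds.boundary t = (D.boundary t - z₀)⁻¹)) := by
  intro D z₀ hz₀
  exact ⟨JordanDomain.ofLoop (ExteriorInversion.continuous_invLoop D hz₀)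
    (ExteriorInversion.periodic_invLoop D z₀) (ExteriorInversion.injOn_invLoop D z₀),
    ExteriorInversion.mem_carrier_ofLoop_invLoop_iff D hz₀, fun _ => rfl⟩

end Summit.CriticalPhenomena.CardyFormulaZ2.Theorems.CardyQContinuation
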